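/-
Copyright (c) 2026 the pub-hodgecm-mathlib formalisation cell (harness21).  Prover seat hodgecm-mathlib-K2E3-p11 (g5), Track B «K2-LIT» ∕ h413
(`stmt-HodgeConjecture-24833`), line `K2_E3_EllipticInputs`, road (11-3-split-nsc) `sig_K2E3CharLocIntNearSemisimpleSplitThreeNonSupercuspidal` (U12 ED. 20 :419),
brick (nsc-RN): A DOMINATED PUSH-FORWARD FUNCTIONAL IS GIVEN BY AN INTEGRABLE DENSITY (Radon–Nikodym, the four parts of a bounded complex weight).  2026-09-04.
-/
import Mathlib.MeasureTheory.Measure.Decomposition.IntegralRNDeriv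
import Mathlib.MeasureTheory.Integral.Bochner.ContinuousLinearMap
import Mathlib.Analysis.SpecialFunctions.Complex.Log
import HarnessLib

/-!
# K2_E3 road (h413), (11-3-split-nsc) brick (nsc-RN) — a dominated push-forward functional `f ↦ ∫_X F·(f∘Ψ) dμ_X` is `f ↦ ∫_G f·Θ dμ_G`, `Θ ∈ L¹`

Cell `pub/hodgecm-mathlib` (D-0151), Track B, seat K2E3-p11 (g5) = road owner of (11-3-split-nsc) (BRICK LIST v1∕v1.1, `K2/STATUS.md` 2026-09-04 07:52Z∕07:55Z;
memo `K2/K2E3-p11/g5/MEMO-ROW11-nsc-bricks.v1.K2E3-p11-g5.md`).  `--supports stmt-HodgeConjecture-24833 --as helper`; THEOREMS ONLY (no definition ∕ instance ∕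
notation ∕ named fact ∕ `sorry`); never imports `Cruxes/…/Lines`.  COUNT-NEUTRAL; generic measure theory (no local field).

WHY.  Row 11 for a class INDUCED FROM A CHARACTER of a Levi of `GL₃(L_w)` asks for `Θ` integrable near `s` with `tr Ind(χ)(f) = ∫ f Θ`; ★ van Dijk's `K M U` form
(`GLn.exists_smoothTrace_parabolicIndGL_eq_integral_KMU`) writes the trace as `∫_X F(x) f(Ψ x) dμ_X` on the parameter space `X = K × M × U` with the bounded weight
`F = C·χ δ_P^{1∕2}` and `Ψ(k,m,u) = k⁻¹(mu)k`, and (nsc-K) DOMINATES `Ψ_* μ_X` on a neighbourhood `U ∋ s` by a locally integrable density; this file turns the two into `Θ`.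
THE RESULT: `X` with a FINITE measure `μ_X` (after localisation), `Ψ : X → G` measurable, `F : X → ℂ` measurable and bounded, `U ⊆ G` measurable with
`(Ψ_* μ_X)|_U ≪ μ_G` (`μ_G` σ-finite).  Then there is `Θ : G → ℂ`, `μ_G`-integrable, with `∫_X F(x) f(Ψ x) dμ_X = ∫_G f Θ dμ_G` for every bounded measurable `f : G → ℂ`
vanishing off `U` (**`exists_integrable_forall_integral_mul_comp_eq`**; the `ℝ≥0`-weight case `exists_integrable_forall_integral_smul_comp_eq` is Radon–Nikodym for the
finite measure `(Ψ_*(φ μ_X))|_U ≪ μ_G` — Mathlib `Measure.rnDeriv`, `withDensity_rnDeriv_eq` — and the complex case is its four-part combination).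
[Folland1999, Thm. 3.8 (Lebesgue–Radon–Nikodym) p. 90, Prop. 3.9] [HarishChandra1999AdmissibleDistributions, §16 p. 77] [vanDijk1972, Thm. p. 237]
HONEST LABEL: HC_CM is proved only modulo the 7 printed citations (2 remaining named inputs: hLiu418 = stmt-HodgeConjecture-24832, h413 =
stmt-HodgeConjecture-24833) until rung 0 closes; count-neutral helper.

## References
* [Folland1999] G. B. Folland, *Real Analysis*, 2nd ed., Wiley (1999), §3.2 Thm. 3.8, Prop. 3.9.
* [HarishChandra1999AdmissibleDistributions] Harish-Chandra (DeBacker–Sally), *Admissible Invariant Distributions on Reductive p-adic Groups* (1999), §16.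
* [vanDijk1972] G. van Dijk, *Computation of certain induced characters of p-adic groups*, Math. Ann. 199 (1972), Thm. p. 237.
-/

set_option autoImplicit false
set_option linter.dupNamespace false

noncomputable section

open MeasureTheory Measure Set
open scoped NNReal ENNReal

namespace Summit.HodgeConjecture.HodgeConjecture.Cruxes.H413.K2E3PushforwardDensityOfDomination

variable {X G : Type*} [MeasurableSpace X] [MeasurableSpace G]

/-! ## §1  One non-negative bounded weight: Radon–Nikodym -/

/-- **Radon–Nikodym for a dominated push-forward, `ℝ≥0` weight.**  `μ_X` finite, `Ψ` measurable, `φ : X → ℝ≥0` measurable and bounded, `(Ψ_*μ_X)|_U ≪ μ_G`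
(`μ_G` σ-finite, `U` measurable): there is an integrable `θ : G → ℝ` with `∫_X φ(x)·f(Ψ x) dμ_X = ∫_G θ·f dμ_G` for all bounded measurable `f : G → ℂ` vanishing off `U`
(`θ = d((Ψ_*(φμ_X))|_U)∕dμ_G`). [cite: Folland1999, §3.2 Thm. 3.8 p. 90] -/
theorem exists_integrable_forall_integral_smul_comp_eq (μX : Measure X) [IsFiniteMeasure μX] {Ψ : X → G} (hΨ : Measurable Ψ)
    {φ : X → ℝ≥0} (hφ : Measurable φ) {M : ℝ≥0} (hφb : ∀ x, φ x ≤ M)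
    (μG : Measure G) [SigmaFinite μG] {U : Set G} (hU : MeasurableSet U) (hac : ((μX.map Ψ).restrict U) ≪ μG) :
    ∃ θ : G → ℝ, Integrable θ μG ∧ ∀ (f : G → ℂ) (B : ℝ), Measurable f → (∀ g, ‖f g‖ ≤ B) → (∀ g, g ∉ U → f g = 0) →
      ∫ x, (φ x : ℝ) • f (Ψ x) ∂μX = ∫ g, θ g • f g ∂μG := by
  -- the finite measure `τ = (Ψ_*(φ μ_X))|_U`
  set μφ : Measure X := μX.withDensity fun x => (φ x : ℝ≥0∞) with hμφ
  have hlin : ∫⁻ x, (φ x : ℝ≥0∞) ∂μX ≤ M * μX univ := by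
    calc ∫⁻ x, (φ x : ℝ≥0∞) ∂μX ≤ ∫⁻ _x, (M : ℝ≥0∞) ∂μX := lintegral_mono fun x => ENNReal.coe_le_coe.2 (hφb x)
      _ = M * μX univ := lintegral_const _
  haveI hμφfin : IsFiniteMeasure μφ := by
    refine isFiniteMeasure_withDensity ((hlin.trans_lt ?_).ne)
    exact ENNReal.mul_lt_top ENNReal.coe_lt_top (measure_lt_top μX _)
  set τ : Measure G := (μφ.map Ψ).restrict U with hτ
  haveI : IsFiniteMeasure (μφ.map Ψ) := isFiniteMeasure_map μφ Ψ
  haveI : IsFiniteMeasure τ := by rw [hτ]; infer_instance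
  -- `τ ≪ μ_G`
  have hτac : τ ≪ μG := by
    refine Measure.AbsolutelyContinuous.mk fun A hA hA0 => ?_
    have h0 : ((μX.map Ψ).restrict U) A = 0 := hac hA0
    rw [Measure.restrict_apply hA, Measure.map_apply hΨ (hA.inter hU)] at h0
    rw [hτ, Measure.restrict_apply hA, Measure.map_apply hΨ (hA.inter hU), hμφ, withDensity_apply _ ((hA.inter hU).preimage hΨ)]
    refine le_antisymm ?_ zero_le
    calc ∫⁻ x in Ψ ⁻¹' (A ∩ U), (φ x : ℝ≥0∞) ∂μX ≤ ∫⁻ _x in Ψ ⁻¹' (A ∩ U), (M : ℝ≥0∞) ∂μX := lintegral_mono fun x => ENNReal.coe_le_coe.2 (hφb x)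
      _ = M * μX (Ψ ⁻¹' (A ∩ U)) := by rw [lintegral_const, Measure.restrict_apply_univ]
      _ = 0 := by rw [h0, mul_zero]
  -- the density
  set θE : G → ℝ≥0∞ := τ.rnDeriv μG with hθE
  refine ⟨fun g => (θE g).toReal, Measure.integrable_toReal_rnDeriv, fun f B hf hfb hfU => ?_⟩
  have hfi : ∀ (ν : Measure G) [IsFiniteMeasure ν], Integrable f ν := fun ν _ =>
    Integrable.of_bound hf.aestronglyMeasurable B (Filter.Eventually.of_forall hfb)
  calc ∫ x, (φ x : ℝ) • f (Ψ x) ∂μX = ∫ x, φ x • f (Ψ x) ∂μX := by rfl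
    _ = ∫ x, f (Ψ x) ∂μφ := by rw [hμφ, integral_withDensity_eq_integral_smul hφ]
    _ = ∫ y, f y ∂(μφ.map Ψ) := (integral_map hΨ.aemeasurable hf.aestronglyMeasurable).symm
    _ = ∫ y in U, f y ∂(μφ.map Ψ) := (setIntegral_eq_integral_of_forall_compl_eq_zero fun y hy => hfU y hy).symm
    _ = ∫ y, f y ∂(μG.withDensity θE) := by rw [hθE, Measure.withDensity_rnDeriv_eq τ μG hτac]
    _ = ∫ g, (θE g).toReal • f g ∂μG := integral_withDensity_eq_integral_toReal_smul (Measure.measurable_rnDeriv _ _) (Measure.rnDeriv_lt_top _ _) f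

/-! ## §2  A bounded complex weight: the four parts -/

/-- **A DOMINATED PUSH-FORWARD FUNCTIONAL HAS AN INTEGRABLE DENSITY.**  `μ_X` finite, `Ψ : X → G` measurable, `F : X → ℂ` measurable with `‖F‖ ≤ M`, `U ⊆ G` measurable with
`(Ψ_*μ_X)|_U ≪ μ_G` (`μ_G` σ-finite): there is `Θ : G → ℂ`, `μ_G`-integrable, with `∫_X F(x)·f(Ψ x) dμ_X = ∫_G f·Θ dμ_G` for every bounded measurable `f : G → ℂ`
vanishing off `U` (the four parts `(Re F)^±, (Im F)^±` of §1). [cite: Folland1999, §3.2 Thm. 3.8 p. 90, Prop. 3.9] [cite: HarishChandra1999AdmissibleDistributions, §16 p. 77] -/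
theorem exists_integrable_forall_integral_mul_comp_eq (μX : Measure X) [IsFiniteMeasure μX] {Ψ : X → G} (hΨ : Measurable Ψ)
    {F : X → ℂ} (hF : Measurable F) {M : ℝ} (hFb : ∀ x, ‖F x‖ ≤ M)
    (μG : Measure G) [SigmaFinite μG] {U : Set G} (hU : MeasurableSet U) (hac : ((μX.map Ψ).restrict U) ≪ μG) :
    ∃ Θ : G → ℂ, Integrable Θ μG ∧ ∀ (f : G → ℂ) (B : ℝ), Measurable f → (∀ g, ‖f g‖ ≤ B) → (∀ g, g ∉ U → f g = 0) →
      ∫ x, F x * f (Ψ x) ∂μX = ∫ g, f g * Θ g ∂μG := by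
  -- the four non-negative parts
  set φ₁ : X → ℝ≥0 := fun x => ((F x).re).toNNReal with hφ₁
  set φ₂ : X → ℝ≥0 := fun x => (-(F x).re).toNNReal with hφ₂
  set φ₃ : X → ℝ≥0 := fun x => ((F x).im).toNNReal with hφ₃
  set φ₄ : X → ℝ≥0 := fun x => (-(F x).im).toNNReal with hφ₄
  have hre : Measurable fun x => (F x).re := Complex.measurable_re.comp hF
  have him : Measurable fun x => (F x).im := Complex.measurable_im.comp hF
  have hφ₁m : Measurable φ₁ := measurable_real_toNNReal.comp hre
  have hφ₂m : Measurable φ₂ := measurable_real_toNNReal.comp hre.neg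
  have hφ₃m : Measurable φ₃ := measurable_real_toNNReal.comp him
  have hφ₄m : Measurable φ₄ := measurable_real_toNNReal.comp him.neg
  have hbound : ∀ (x : X) (t : ℝ), |t| ≤ ‖F x‖ → t.toNNReal ≤ M.toNNReal := fun x t ht =>
    Real.toNNReal_le_toNNReal ((le_abs_self t).trans (ht.trans (hFb x)))
  have hφ₁b : ∀ x, φ₁ x ≤ M.toNNReal := fun x => hbound x _ (Complex.abs_re_le_norm (F x))
  have hφ₂b : ∀ x, φ₂ x ≤ M.toNNReal := fun x => hbound x _ (by rw [abs_neg]; exact Complex.abs_re_le_norm (F x))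
  have hφ₃b : ∀ x, φ₃ x ≤ M.toNNReal := fun x => hbound x _ (Complex.abs_im_le_norm (F x))
  have hφ₄b : ∀ x, φ₄ x ≤ M.toNNReal := fun x => hbound x _ (by rw [abs_neg]; exact Complex.abs_im_le_norm (F x))
  obtain ⟨θ₁, hθ₁, h₁⟩ := exists_integrable_forall_integral_smul_comp_eq μX hΨ hφ₁m hφ₁b μG hU hac
  obtain ⟨θ₂, hθ₂, h₂⟩ := exists_integrable_forall_integral_smul_comp_eq μX hΨ hφ₂m hφ₂b μG hU hac
  obtain ⟨θ₃, hθ₃, h₃⟩ := exists_integrable_forall_integral_smul_comp_eq μX hΨ hφ₃m hφ₃b μG hU hac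
  obtain ⟨θ₄, hθ₄, h₄⟩ := exists_integrable_forall_integral_smul_comp_eq μX hΨ hφ₄m hφ₄b μG hU hac
  set Θ : G → ℂ := fun g => ((θ₁ g - θ₂ g : ℝ) : ℂ) + ((θ₃ g - θ₄ g : ℝ) : ℂ) * Complex.I with hΘ
  have hΘi : Integrable Θ μG :=
    ((hθ₁.sub hθ₂).ofReal).add (((hθ₃.sub hθ₄).ofReal).mul_const _)
  refine ⟨Θ, hΘi, fun f B hf hfb hfU => ?_⟩
  -- pointwise decomposition of the weight
  have hFdec : ∀ x, F x = (((φ₁ x : ℝ) - (φ₂ x : ℝ) : ℝ) : ℂ) + (((φ₃ x : ℝ) - (φ₄ x : ℝ) : ℝ) : ℂ) * Complex.I := by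
    intro x
    have e1 : ((φ₁ x : ℝ) - (φ₂ x : ℝ) : ℝ) = (F x).re := by
      show ((((F x).re).toNNReal : ℝ) - (((-(F x).re).toNNReal : ℝ≥0) : ℝ)) = (F x).re
      rw [Real.coe_toNNReal', Real.coe_toNNReal']
      exact max_zero_sub_max_neg_zero_eq_self _
    have e2 : ((φ₃ x : ℝ) - (φ₄ x : ℝ) : ℝ) = (F x).im := by
      show ((((F x).im).toNNReal : ℝ) - (((-(F x).im).toNNReal : ℝ≥0) : ℝ)) = (F x).im
      rw [Real.coe_toNNReal', Real.coe_toNNReal']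
      exact max_zero_sub_max_neg_zero_eq_self _
    rw [e1, e2]
    exact (Complex.re_add_im (F x)).symm
  -- integrability on the `X` side
  have hfΨ : ∀ φ : X → ℝ≥0, Measurable φ → (∀ x, φ x ≤ M.toNNReal) → Integrable (fun x => (φ x : ℝ) • f (Ψ x)) μX := by
    intro φ hφm hφb'
    refine Integrable.of_bound ((measurable_coe_nnreal_real.comp hφm).smul (hf.comp hΨ)).aestronglyMeasurable (M.toNNReal * B)
      (Filter.Eventually.of_forall fun x => ?_)
    rw [norm_smul, Real.norm_of_nonneg (NNReal.coe_nonneg _)]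
    exact mul_le_mul (NNReal.coe_le_coe.2 (hφb' x)) (hfb _) (norm_nonneg _) (NNReal.coe_nonneg _)
  -- integrability on the `G` side
  have hθf : ∀ θ : G → ℝ, Integrable θ μG → Integrable (fun g => θ g • f g) μG := fun θ hθ =>
    hθ.smul_bdd B hf.aestronglyMeasurable (Filter.Eventually.of_forall hfb)
  -- assemble
  have hL : ∫ x, F x * f (Ψ x) ∂μX =
      ((∫ x, (φ₁ x : ℝ) • f (Ψ x) ∂μX) - ∫ x, (φ₂ x : ℝ) • f (Ψ x) ∂μX) +
        ((∫ x, (φ₃ x : ℝ) • f (Ψ x) ∂μX) - ∫ x, (φ₄ x : ℝ) • f (Ψ x) ∂μX) * Complex.I := by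
    have hpt : ∀ x, F x * f (Ψ x) = (((φ₁ x : ℝ) • f (Ψ x) - (φ₂ x : ℝ) • f (Ψ x)) +
        ((φ₃ x : ℝ) • f (Ψ x) - (φ₄ x : ℝ) • f (Ψ x)) * Complex.I) := by
      intro x
      rw [hFdec x]
      simp only [Complex.real_smul, Complex.ofReal_sub]
      ring
    simp_rw [hpt]
    rw [integral_add ((hfΨ φ₁ hφ₁m hφ₁b).sub' (hfΨ φ₂ hφ₂m hφ₂b)) (((hfΨ φ₃ hφ₃m hφ₃b).sub' (hfΨ φ₄ hφ₄m hφ₄b)).mul_const _),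
      integral_sub (hfΨ φ₁ hφ₁m hφ₁b) (hfΨ φ₂ hφ₂m hφ₂b), integral_mul_const, integral_sub (hfΨ φ₃ hφ₃m hφ₃b) (hfΨ φ₄ hφ₄m hφ₄b)]
  have hR : ∫ g, f g * Θ g ∂μG =
      ((∫ g, θ₁ g • f g ∂μG) - ∫ g, θ₂ g • f g ∂μG) + ((∫ g, θ₃ g • f g ∂μG) - ∫ g, θ₄ g • f g ∂μG) * Complex.I := by
    have hpt : ∀ g, f g * Θ g = ((θ₁ g • f g - θ₂ g • f g) + (θ₃ g • f g - θ₄ g • f g) * Complex.I) := by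
      intro g
      rw [hΘ]
      simp only [Complex.real_smul, Complex.ofReal_sub]
      ring
    simp_rw [hpt]
    rw [integral_add ((hθf θ₁ hθ₁).sub' (hθf θ₂ hθ₂)) (((hθf θ₃ hθ₃).sub' (hθf θ₄ hθ₄)).mul_const _),
      integral_sub (hθf θ₁ hθ₁) (hθf θ₂ hθ₂), integral_mul_const, integral_sub (hθf θ₃ hθ₃) (hθf θ₄ hθ₄)]
  rw [hL, hR, h₁ f B hf hfb hfU, h₂ f B hf hfb hfU, h₃ f B hf hfb hfU, h₄ f B hf hfb hfU]

end Summit.HodgeConjecture.HodgeConjecture.Cruxes.H413.K2E3PushforwardDensityOfDomination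

end
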